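import Literature.NumberTheory.Automorphic.Liu2021.Def411WeilCarriersAtChiSplittingTensor
import Literature.NumberTheory.Automorphic.UnitaryGroupDualPairLocalLine
import Literature.NumberTheory.Automorphic.RestrictedTensorProductRepTransport
import HarnessLib

/-!
# A representation identified with the central `χ₁`-coinvariants of `Ω_𝓢` IS `⊗'_v` of the local central coinvariants read along `U(J_V)(F_v) → U(J_V ⊗ J_W)(F_v)`

Topic `Literature/NumberTheory/Automorphic`; proof file (one theorem: no definition, no named fact, no instance); count-neutral.
This is the GENERIC junction behind the d6 line's «S4c-H» (cell `hodgecm-mathlib`): it is stated for an ARBITRARY family `𝓢` of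
local splittings of the dual pair `U(J_V) × U(J_W)` (`J_W` a line), an arbitrary continuous character `χ₁` of `E¹(𝔸_{F,f})` with a
survival set `S₁`, and an arbitrary representation `ρ` of `U(J_V)(𝔸_{F,f})` GIVEN together with an intertwiner
`T : ρ ≃ Coinv(Ω_𝓢 ∘ (u ↦ u·1_n), χ₁)` for the action `k ↦ Ω_𝓢(reindex(k ⊗ 1))` — so that its statement elaborates on small terms and
the consumer instantiates it by `exact` at THE `θ`-package (generalise-then-specialise; the instantiated statement of record is
`Liu2021.Def411WeilCarriers.exists_isRestrictedTensorProductRep_rhoVAtLine_comp_finAdelicEquiv_symm`).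

**Theorem.** Under these data, `ρ ∘ finAdelicEquiv⁻¹` on `Πʳ_v [U(J_V)(F_v), U(J_V)(𝒪_v)]` is `IsRestrictedTensorProductRep` of the
local representations `Coinv(ω_{𝓢,v} ∘ (z ↦ z·1_n), χ_{1,v}) ∘ localLineInl v` with exceptional set `S₁`.  Proof = composition BY
NAME of ★ `exists_isRestrictedTensorProductRep_omegaPi_center` (the `⊗'` model of the global central coinvariants of `Ω_Π`),
★ `IsRestrictedTensorProductRep.comp` along `localLineInl` (★ `eventually_localLineInl_mapsTo_localInt`),
★ `exists_equiv_omega_center_omegaPi_center` (the intertwiner `E′`), ★ `finAdelicEquiv_finPairEmb_inl_eq_mapAlong` and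
★ `IsRestrictedTensorProductRep.comp_linearEquiv` along `(T.trans E′)⁻¹`.

## References
* D. Flath, *Decomposition of representations into tensor products*, Corvallis 1979, part 1, §2 Example 2. [Flath1979]
* Y. Liu, Camb. J. Math. 9 (2021), Def. 4.11 (l. 2092–2096), App. D §D.1 Steps 1–3. [Liu2021]
* S. Gelbart, J. Rogawski, Invent. Math. 105 (1991), §3.1 Prop. 3.1.1 p. 455, §3.2 p. 457. [GelbartRogawski1991]
-/

set_option autoImplicit false

noncomputable section

open scoped Matrix Kronecker TensorProduct Classical RestrictedProduct
open NumberField NumberField.mixedEmbedding IsDedekindDomain Filter Set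
open Literature.NumberTheory Literature.NumberTheory.Automorphic Literature.NumberTheory.Automorphic.UnitaryGroup
open Literature.NumberTheory.Weil1964 Literature.RepresentationTheory
open Literature.RepresentationTheory.HeisenbergGroup

namespace Literature.NumberTheory.Automorphic

/-! ## §1 Transport of a `⊗'` model to a representation of an isomorphic group along an intertwining isomorphism -/

section Transport

universe u uk uG uA v w w'

variable {ι : Type u} {k : Type uk} [CommRing k] {G : ι → Type uG} [∀ i, Group (G i)] [∀ i, TopologicalSpace (G i)]
  {K : ∀ i, Subgroup (G i)} {V : ι → Type v} [∀ i, AddCommGroup (V i)] [∀ i, Module k (V i)]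
  {ρ : ∀ i, Representation k (G i) (V i)} {x₀ : ∀ i, V i} [DecidableEq ι]
  {W : Type w} [AddCommGroup W] [Module k W] {W' : Type w'} [AddCommGroup W'] [Module k W']
  {π : Representation k (Πʳ i, [G i, K i]) W} {hx₀ : ∀ᶠ i in cofinite, x₀ i ∈ (ρ i).fixedPoints (K i)}
  {j : RestrictedFamily V x₀ → W} {S₀ : Finset ι}
  {A : Type uA} [Group A] [TopologicalSpace A]

/-- **Transport of `π ≅ ⊗'_i ρ_i` to a representation `π'` of a group `A ≃ₜ* Πʳ_i [G_i, K_i]`.**  If `(π, W, j) ≅ ⊗'_i (ρ_i, x₀_i)`,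
`f : A ≃ₜ* Πʳ_i [G_i, K_i]` and `e : W' ≃ₗ W` intertwines `π'` (on `W'`) with `π ∘ f` (`e (π' a w) = π (f a) (e w)`), then
`(π' ∘ f⁻¹, W', e⁻¹ ∘ j) ≅ ⊗'_i (ρ_i, x₀_i)` with the same exceptional set (★ `comp_linearEquiv` along `e⁻¹`, the intertwining
read backwards through `f ∘ f⁻¹ = id`, `e ∘ e⁻¹ = id`). [cite: Flath1979, §2 Example 2] -/
theorem IsRestrictedTensorProductRep.comp_symm_of_linearEquiv (h : IsRestrictedTensorProductRep ρ π hx₀ j S₀)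
    (f : A ≃ₜ* (Πʳ i, [G i, K i])) (e : W' ≃ₗ[k] W) (π' : Representation k A W')
    (he : ∀ (a : A) (w : W'), e (π' a w) = π (f a) (e w)) :
    IsRestrictedTensorProductRep ρ (π'.comp f.symm.toMonoidHom) hx₀ (e.symm ∘ j) S₀ :=
  h.comp_linearEquiv e.symm _ fun g w => (e.symm_apply_eq).2 <| by
    rw [show π'.comp f.symm.toMonoidHom g = π' (f.symm g) from rfl, he, ContinuousMulEquiv.apply_symm_apply,
      LinearEquiv.apply_symm_apply]

end Transport

end Literature.NumberTheory.Automorphic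

/-! ## §2 The junction: a representation identified with the central `χ₁`-coinvariants of `Ω_𝓢`, read on `U(J_V)` along `localLineInl` -/

namespace Literature.NumberTheory.GelbartRogawski1991.UnitaryDualPair.WeilCoinv

variable (F E : Type) [Field F] [NumberField F] [Field E] [NumberField E] [Algebra F E]
variable (c : E ≃ₐ[F] E) (N : ℕ) {n : ℕ} (e : Fin N × Fin 1 ≃ Fin n)
variable (JV : Matrix (Fin N) (Fin N) E) (JW : Matrix (Fin 1) (Fin 1) E)
variable {TV : Matrix (Fin N) (Fin N) F} {TW : Matrix (Fin 1) (Fin 1) F}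
variable [Algebra.IsQuadraticExtension F E] {δ : E} (hcδ : c δ = -δ) (hδ : δ ≠ 0) {d : F}
  (hd : δ * δ = algebraMap F E d) (hV : TV.IsSymm) (hW : TW.IsSymm)
  (hJV : JV = TV.map (algebraMap F E)) (hJW : JW = TW.map (algebraMap F E)) (hJW0 : JW 0 0 ≠ 0)
  (𝓢 : LocalSplitting.FinLocalSplittings F E c n hcδ hδ hd (gram F e TV TW) (isSymm_gram F e hV hW)
    (reindex_kronecker_eq_gram_map F E e hJV hJW))

universe w in
set_option maxHeartbeats 400000 in -- measured: statement 30 k + proof task 196 k (A-p06 (g14) census, `(160 k, 200 k]` cliff class) — the two `⊗`/coinvariant ∃-statements instantiated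
/-- **A representation `ρ` of `U(J_V)(𝔸_{F,f})` identified (by `T`) with the central `χ₁`-coinvariants of `Ω_𝓢` for the action
`k ↦ Ω_𝓢(reindex(k ⊗ 1))` is, read on `Πʳ_v [U(J_V)(F_v), U(J_V)(𝒪_v)]` through `finAdelicEquiv⁻¹`, the restricted tensor product of
the local central coinvariants `Coinv(ω_{𝓢,v} ∘ (z ↦ z·1_n), χ_{1,v})` restricted along `localLineInl v`, with exceptional set the
survival set `S₁`** (generic form of the d6 line's «S4c-H»; [Flath1979, §2 Example 2] transport + restriction of the `⊗'` model of
[Liu2021, Def. 4.11] «`ω(μ,ε,χ) := ⊗'_v ω(μ_v,ε_v,χ_v)`», App. D §D.1 Steps 1–3).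
[cite: Flath1979, §2 Example 2] [cite: Liu2021, Def. 4.11 (l. 2092–2096), App. D §D.1 Steps 1–3] [cite: GelbartRogawski1991, §3.2 p. 457] -/
theorem exists_isRestrictedTensorProductRep_comp_finAdelicEquiv_symm_of_equiv_omega_center
    {χ₁ : finAdelicOne F E c →* ℂˣ} (hχ₁ : Continuous χ₁)
    {S₁ : Finset (HeightOneSpectrum (𝓞 F))}
    (hx₀N : ∀ v ∉ S₁,
      TwistedCoinv.mk (show Representation ℂ (localPi E c 1 JW v) _ from
          (𝓢.omegaLoc v).comp (localCenter E c n (Matrix.reindex e e (JV ⊗ₖ JW)) JW hJW0 v))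
        (localCharOfCenter F E c JW hJW0 χ₁ v) (unitVec F (Fin n) v) ≠ 0)
    {W : Type w} [AddCommGroup W] [Module ℂ W] (ρ : Representation ℂ (finAdelic F E c N JV) W)
    (T : W ≃ₗ[ℂ] TwistedCoinv.Coinv (show Representation ℂ (finAdelicOne F E c) _ from
        𝓢.Omega.comp (finAdelicCenter F E c n (Matrix.reindex e e (JV ⊗ₖ JW)))) χ₁)
    (hT : ∀ (k : finAdelic F E c N JV) (x : W),
        T (ρ k x) = TwistedCoinv.rep χ₁
            (show Representation ℂ (finAdelic F E c N JV) _ from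
              𝓢.Omega.comp ((finPairEmb F E c N 1 e JV JW).comp (MonoidHom.inl _ _)))
            (commute_omega_finPairEmb_finAdelicCenter F E c N e JV JW hcδ hδ hd hV hW hJV hJW 𝓢) k (T x)) :
    ∃ jW, IsRestrictedTensorProductRep (K := fun v => localInt E c N JV v)
        (fun v => show Representation ℂ (localPi E c N JV v) _ from
          (TwistedCoinv.rep (localCharOfCenter F E c JW hJW0 χ₁ v) (𝓢.omegaLoc v)
            (commute_omegaLoc_localCenter F E c N e JV JW hcδ hδ hd hV hW hJV hJW hJW0 𝓢 v)).comp
            (localLineInl E c N e JV JW v))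
        (ρ.comp (finAdelicEquiv F E c N JV).symm.toMonoidHom)
        (Representation.eventually_mem_fixedPoints_comp (fun v => localLineInl E c N e JV JW v)
          (IsRestrictedTensorProductRep.eventually_mk_mem_fixedPoints
            (commute_omegaLoc_localCenter F E c N e JV JW hcδ hδ hd hV hW hJV hJW hJW0 𝓢) 𝓢.unitVec_mem_fixedPoints)
          (eventually_localLineInl_mapsTo_localInt E c N e JV JW))
        jW S₁ :=
  -- the `⊗'` model of the global central coinvariants of `Ω_Π` (exceptional set `S₁`) and the intertwiner `E'` between the two
  -- presentations of the central quotient (both consumed as terms: `obtain` on these ∃-types costs ≈ 180 k heartbeats more)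
  (exists_isRestrictedTensorProductRep_omegaPi_center F E c N e JV JW hcδ hδ hd hV hW hJV hJW hJW0 𝓢 hχ₁ hx₀N).elim
    fun _ h3 => (exists_equiv_omega_center_omegaPi_center F E c N e JV JW hcδ hδ hd hV hW hJV hJW hJW0 𝓢 χ₁).elim
    -- pull the model back along `Πʳ localLineInl`, then transport it to `ρ ∘ finAdelicEquiv⁻¹` along `(T.trans E')⁻¹`; the
    -- intertwining `E' (T (ρ k x)) = Coinv(Ω_Π)(Πʳ localLineInl (finAdelicEquiv k)) (E' (T x))` is `hT`, `hE'.2` and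
    -- ★ `finAdelicEquiv_finPairEmb_inl_eq_mapAlong`, composed as a `congrArg`/`Eq.trans` chain (no `rw` across the telescopes)
    fun E' hE' => ⟨_, (h3.comp (fun v => localLineInl E c N e JV JW v)
        (eventually_localLineInl_mapsTo_localInt E c N e JV JW)).comp_symm_of_linearEquiv (finAdelicEquiv F E c N JV)
      (T.trans E') ρ fun k x =>
        (congrArg E' (hT k x)).trans ((hE'.2 k (T x)).trans
          (congrArg (fun g => TwistedCoinv.rep (charOfCenter F E c JW hJW0 χ₁) 𝓢.OmegaPi
              (commute_omegaPi_mapAlong_localCenter F E c N e JV JW hcδ hδ hd hV hW hJV hJW hJW0 𝓢) g (E' (T x)))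
            (finAdelicEquiv_finPairEmb_inl_eq_mapAlong E c N e JV JW k)))⟩

end Literature.NumberTheory.GelbartRogawski1991.UnitaryDualPair.WeilCoinv

end
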